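import Summits.BirchSwinnertonDyer.BirchSwinnertonDyer.Theorems.SmallImageMuTransferMuTransferX9StepFourReciprocitySeams
import HarnessLib

/-!
# K6 crux `MuTransferX9` (stmt-BirchSwinnertonDyer-19276), MU-TRANSFER-PROOF §5 STEP 4 with the
# exceptional set `S` an ARBITRARY SET of finite places (the binder shape of skeleton v5's
# `stub_stepsTwoFourX9`: `S₁ : Set (HeightOneSpectrum (𝓞 ℚ))`, `S₀ ⊆ S₁`, no finiteness)

Cell `b2b-bsdres`, unit `b2b-bsdres-x10` (N2 = X10b at `p = 3` class lead, GEN 38; G4 = STEP 4 hand of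
the assembler's cut of `stub_coreX9`, crux 19276, cell `bsd-smallim`; skeleton v5 sha16 bbfcbeb8eb041500
REGISTERED 13:39Z by `bsd-smallim-k6-c2` g3). HONEST FRAMING: TOOL theorems; no definition, no named fact, no
`sorry`; nothing is asserted about any curve, nothing is booked; X9 stays TYPED at class level, X10b (N2)
keeps its label CONSTRUCTION-SHAPED / NEEDS X_A3. `--supports stmt-BirchSwinnertonDyer-19276` (helper;
closes nothing). PARTITION (D-0054): X9 (A4) × `p ∈ {5, 7}` · X10b (A5) × `p = 3` (prime-generic, `p` odd).

## Why a fourth STEP-4 file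

`…X9StepFourReciprocity{,Twist,Seams}` index the exceptional places by a `Finset`. Skeleton v5's
`stub_stepsTwoFourX9` quantifies `∀ (ε) (S₁ : Set _) (Ψ) (Ψc), S₀ ⊆ S₁ → … → (∀ v ∉ S₁, loc_v Ψ ∈ H¹_ur) →
(∀ v ∈ S₁, loc_v (T^[ε] Ψ) = 0) → … ∀ q ∉ S₁ …` with `S₁` an arbitrary SET. Finiteness was never used in
STEP 4 (the Poitou–Tate predicate `SumLocalTermEqZero.localTerm_eq_zero` only needs every local term but the
one at `q` to vanish, and each vanishes for its own reason: `n` odd at `∞`, the hypothesis on `S`,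
unramified off `S ∪ {q}`), so this file re-runs the three levels with `S : Set (HeightOneSpectrum (𝓞 K))`:

* §1 generic: `localTerm_inr_eq_zero_of_unramified_outside_set` (+ `_of_isUnramifiedAt_set`), the pairing
  form `localTerm_pairingDual_eq_zero_of_unramified_outside_set` and its family form `…_map_…_set`;
* §2 twists: `localTerm_twistDualMap_eq_zero_of_unramified_outside_set`, and — in EXACTLY the stub's
  hypothesis shape (`Ψ` unramified off `S`, `loc_v (T^[ε] Ψ) = 0` on `S`, GLOBAL iterate) —
  **`localTerm_iterate_shiftH1_eq_zero_of_stub_hypotheses`**: for every `k`, the local term at `q ∉ S` of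
  `(T^k x, (twistDualMap)_* (T^ε Ψ))` vanishes, `x` unramified off `S ∪ {q}` (the Kolyvagin class);
* §3 the local-class cup-product form at `q` (koly's `q`-term currency):
  `inv_cupProduct_restrict_iterate_localShift_eq_zero_of_stub_hypotheses`.

References: MU-TRANSFER-PROOF §5 STEP 4; J. S. Milne, *Arithmetic Duality Theorems* (2006), I Thm. 4.10 (b),
Thm. 2.6 [MilneADT2006]; J.-P. Serre, *Galois Cohomology* (1997), I §2.4 [SerreGaloisCohomology1997].
-/

-- the summit and its single problem are both named `BirchSwinnertonDyer` (registry layout D-0017)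
set_option linter.dupNamespace false

set_option autoImplicit false

noncomputable section

open scoped ContRepresentation
open Function NumberField IsDedekindDomain Field
open scoped NumberField
open Literature.NumberTheory.GaloisRepresentations
open Literature.NumberTheory.GaloisRepresentations.DiscreteGaloisModule (mu MuCarrier pairing TateDual
  tateDual pairingDualIntertwining)
open Literature.NumberTheory.GaloisCohomology
open Literature.NumberTheory.EllipticCurves
open Summit.BirchSwinnertonDyer.Rank1Residual.GaloisImage

universe u

namespace Summit.BirchSwinnertonDyer.BirchSwinnertonDyer.Rank1Residual.StepFour

variable {K : Type u} [Field K] [NumberField K]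

/-! ### §1 Generic: `S` a set of finite places -/

section Generic

variable {M : Type u} [AddCommGroup M] [TopologicalSpace M] [DiscreteTopology M] [Finite M] {n : ℕ}

/-- **MU-TRANSFER-PROOF §5 STEP 4 (reciprocity), generic form, `S` an arbitrary SET of finite places.** As
`localTerm_inr_eq_zero_of_unramified_outside` (whose proof never used finiteness): `n` odd, `inv` with the
Poitou–Tate vanishing, `x ∈ H¹(K, M)`, `y ∈ H¹(K, M^D)` unramified at every finite `v ∉ S`, `v ≠ q` where
inertia fixes `M`, `M^D`, local terms vanishing on `S` ⟹ the local term at `q` vanishes.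
[cite: MilneADT2006, Ch. I, Thm. 4.10(b)] -/
theorem localTerm_inr_eq_zero_of_unramified_outside_set [NeZero n] (hn : Odd n)
    {inv : LocalInvariants K n} (hPT : inv.SumLocalTermEqZero) (ρ : DiscreteGaloisModule K M)
    (hM : ∀ m : M, n • m = 0) (S : Set (HeightOneSpectrum (𝓞 K))) (q : HeightOneSpectrum (𝓞 K))
    (x : galoisCohomology ρ 1) (y : galoisCohomology (ρ.tateDual n) 1)
    (hI : ∀ v ∉ S, v ≠ q → ∀ t ∈ absInertia (v.adicCompletion K), ∀ m : M,
      GaloisRep.toLocal v ρ t m = m)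
    (hID : ∀ v ∉ S, v ≠ q → ∀ t ∈ absInertia (v.adicCompletion K), ∀ f : TateDual K M n,
      GaloisRep.toLocal v (ρ.tateDual n) t f = f)
    (hx : ∀ v ∉ S, v ≠ q → galoisCohomology.localization ρ (Sum.inr v) 1 x ∈
      DiscreteGaloisModule.unramifiedSubgroup (GaloisRep.toLocal v ρ) 1)
    (hy : ∀ v ∉ S, v ≠ q → galoisCohomology.localization (ρ.tateDual n) (Sum.inr v) 1 y ∈
      DiscreteGaloisModule.unramifiedSubgroup (GaloisRep.toLocal v (ρ.tateDual n)) 1)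
    (hS : ∀ v ∈ S, inv.localTerm ρ (Sum.inr v) x y = 0) :
    inv.localTerm ρ (Sum.inr q) x y = 0 := by
  classical
  refine hPT.localTerm_eq_zero ρ hM x y (Sum.inr q) fun v hv => ?_
  rcases v with w | v
  · exact localTerm_inl_eq_zero_of_odd inv ρ hn hM w x y
  · by_cases hvS : v ∈ S
    · exact hS v hvS
    · have hvq : v ≠ q := fun h => hv (by rw [h])
      exact localTerm_inr_eq_zero_of_mem_unramifiedSubgroup inv ρ v (hI v hvS hvq) (hID v hvS hvq)
        (hx v hvS hvq) (hy v hvS hvq)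

/-- **STEP 4, generic, `S` a set, inertia hypotheses from `IsUnramifiedAt` and `v ∤ n`.**
[cite: MilneADT2006, Ch. I, Thm. 4.10(b)] -/
theorem localTerm_inr_eq_zero_of_unramified_outside_of_isUnramifiedAt_set [NeZero n] (hn : Odd n)
    {inv : LocalInvariants K n} (hPT : inv.SumLocalTermEqZero) (ρ : DiscreteGaloisModule K M)
    (hM : ∀ m : M, n • m = 0) (S : Set (HeightOneSpectrum (𝓞 K))) (q : HeightOneSpectrum (𝓞 K))
    (x : galoisCohomology ρ 1) (y : galoisCohomology (ρ.tateDual n) 1)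
    (hn' : ∀ v ∉ S, v ≠ q → ((n : ℕ) : 𝓞 K) ∉ v.asIdeal)
    (hur : ∀ v ∉ S, v ≠ q → GaloisRep.IsUnramifiedAt v ρ)
    (hx : ∀ v ∉ S, v ≠ q → galoisCohomology.localization ρ (Sum.inr v) 1 x ∈
      DiscreteGaloisModule.unramifiedSubgroup (GaloisRep.toLocal v ρ) 1)
    (hy : ∀ v ∉ S, v ≠ q → galoisCohomology.localization (ρ.tateDual n) (Sum.inr v) 1 y ∈
      DiscreteGaloisModule.unramifiedSubgroup (GaloisRep.toLocal v (ρ.tateDual n)) 1)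
    (hS : ∀ v ∈ S, inv.localTerm ρ (Sum.inr v) x y = 0) :
    inv.localTerm ρ (Sum.inr q) x y = 0 := by
  refine localTerm_inr_eq_zero_of_unramified_outside_set hn hPT ρ hM S q x y
    (fun v hvS hvq t ht m => ?_) (fun v hvS hvq t ht f => ?_) hx hy hS
  · have h := (GaloisRep.isUnramifiedAt_iff_toLocal_holds v ρ).1 (hur v hvS hvq) t ht
    rw [h]
    rfl
  · exact UnramifiedCup.toLocal_tateDual_apply_of_mem_absInertia_of_not_mem ρ n v (hn' v hvS hvq)
      (hur v hvS hvq) ht f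

variable {M₂ : Type u} [AddCommGroup M₂] [TopologicalSpace M₂] [DiscreteTopology M₂]
variable {ρ₁ : DiscreteGaloisModule K M} {ρ₂ : DiscreteGaloisModule K M₂}
variable {B : M →+ M₂ →+ MuCarrier K n}
variable (hB : ∀ (σ : absoluteGaloisGroup K) (x : M) (y : M₂), B (ρ₁ σ x) (ρ₂ σ y) = mu K n σ (B x y))
include hB

/-- **STEP 4 for an equivariant pairing `B : M₁ × M₂ → μₙ`, `S` a set** (local-term form, `S` discharged
by `loc_v y = 0`). [cite: MilneADT2006, Ch. I, Thm. 4.10(b)] -/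
theorem localTerm_pairingDual_eq_zero_of_unramified_outside_set [NeZero n] (hn : Odd n)
    {inv : LocalInvariants K n} (hPT : inv.SumLocalTermEqZero) (hM : ∀ m : M, n • m = 0)
    (S : Set (HeightOneSpectrum (𝓞 K))) (q : HeightOneSpectrum (𝓞 K))
    (x : galoisCohomology ρ₁ 1) (y : galoisCohomology ρ₂ 1)
    (hI : ∀ v ∉ S, v ≠ q → ∀ t ∈ absInertia (v.adicCompletion K), ∀ m : M,
      GaloisRep.toLocal v ρ₁ t m = m)
    (hID : ∀ v ∉ S, v ≠ q → ∀ t ∈ absInertia (v.adicCompletion K), ∀ f : TateDual K M n,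
      GaloisRep.toLocal v (ρ₁.tateDual n) t f = f)
    (hx : ∀ v ∉ S, v ≠ q → galoisCohomology.localization ρ₁ (Sum.inr v) 1 x ∈
      DiscreteGaloisModule.unramifiedSubgroup (GaloisRep.toLocal v ρ₁) 1)
    (hy : ∀ v ∉ S, v ≠ q → galoisCohomology.localization ρ₂ (Sum.inr v) 1 y ∈
      DiscreteGaloisModule.unramifiedSubgroup (GaloisRep.toLocal v ρ₂) 1)
    (hS : ∀ v ∈ S, galoisCohomology.localization ρ₂ (Sum.inr v) 1 y = 0) :
    inv.localTerm ρ₁ (Sum.inr q) x (galoisCohomology.map (pairingDualIntertwining hB) 1 y) = 0 := by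
  refine localTerm_inr_eq_zero_of_unramified_outside_set hn hPT ρ₁ hM S q x _ hI hID hx
    (fun v hvS hvq => localization_map_mem_unramifiedSubgroup _ v (hy v hvS hvq)) fun v hvS => ?_
  refine localTerm_eq_zero_of_localization_right_eq_zero inv ρ₁ (Sum.inr v) x ?_
  rw [localization_map_eq, hS v hvS]
  exact map_zero _

/-- **STEP 4, family form, `S` a set**: the same for `(φ_* x, y)`, `φ` any equivariant endomorphism of
`M₁`. [cite: MilneADT2006, Ch. I, Thm. 4.10(b)] -/
theorem localTerm_map_pairingDual_eq_zero_of_unramified_outside_set [NeZero n] (hn : Odd n)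
    {inv : LocalInvariants K n} (hPT : inv.SumLocalTermEqZero) (hM : ∀ m : M, n • m = 0)
    (S : Set (HeightOneSpectrum (𝓞 K))) (q : HeightOneSpectrum (𝓞 K))
    (x : galoisCohomology ρ₁ 1) (y : galoisCohomology ρ₂ 1)
    (hI : ∀ v ∉ S, v ≠ q → ∀ t ∈ absInertia (v.adicCompletion K), ∀ m : M,
      GaloisRep.toLocal v ρ₁ t m = m)
    (hID : ∀ v ∉ S, v ≠ q → ∀ t ∈ absInertia (v.adicCompletion K), ∀ f : TateDual K M n,
      GaloisRep.toLocal v (ρ₁.tateDual n) t f = f)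
    (hx : ∀ v ∉ S, v ≠ q → galoisCohomology.localization ρ₁ (Sum.inr v) 1 x ∈
      DiscreteGaloisModule.unramifiedSubgroup (GaloisRep.toLocal v ρ₁) 1)
    (hy : ∀ v ∉ S, v ≠ q → galoisCohomology.localization ρ₂ (Sum.inr v) 1 y ∈
      DiscreteGaloisModule.unramifiedSubgroup (GaloisRep.toLocal v ρ₂) 1)
    (hS : ∀ v ∈ S, galoisCohomology.localization ρ₂ (Sum.inr v) 1 y = 0)
    (φ : ρ₁.toContRepresentation →ⁱL ρ₁.toContRepresentation) :
    inv.localTerm ρ₁ (Sum.inr q) (galoisCohomology.map φ 1 x)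
      (galoisCohomology.map (pairingDualIntertwining hB) 1 y) = 0 :=
  localTerm_pairingDual_eq_zero_of_unramified_outside_set hB hn hPT hM S q _ y hI hID
    (fun v hvS hvq => localization_map_mem_unramifiedSubgroup φ v (hx v hvS hvq)) hy hS

end Generic

/-! ### §2 The twists, in the hypothesis shape of `stub_stepsTwoFourX9` -/

section Twist

variable {p : ℕ} [Fact p.Prime] (κ : ZpExtension K p)
variable {M M' : Type u} [AddCommGroup M] [TopologicalSpace M] [DiscreteTopology M] [Finite M]
  [AddCommGroup M'] [TopologicalSpace M'] [DiscreteTopology M']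
variable (ρ : DiscreteGaloisModule K M) (ρ' : DiscreteGaloisModule K M')
  (hM : ∀ x : M, p • x = 0) (hM' : ∀ x : M', p • x = 0) (J : ℕ)
variable {e : M →+ M' →+ MuCarrier K p}
  (he : ∀ (g : absoluteGaloisGroup K) (m : M) (m' : M'), e (ρ g m) (ρ' g m') = mu K p g (e m m'))
include he

/-- **STEP 4 on the Iwasawa twists, `S` a set.** `p` odd; `inv` with the Poitou–Tate vanishing; every
finite `v ∉ S`, `v ≠ q` has `v ∤ p` and `ρ` unramified; `x ∈ H¹(K, 𝒯_J(ρ, κ))`, `y ∈ H¹(K, 𝒯_J(ρ′, κ⁻¹))`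
unramified off `S ∪ {q}`; `loc_v y = 0` on `S` ⟹ the local term at `q` of `(x, (twistDualMap)_* y)`
vanishes. [cite: MilneADT2006, Ch. I, Thm. 4.10(b)] -/
theorem localTerm_twistDualMap_eq_zero_of_unramified_outside_set (hp : p ≠ 2)
    {inv : LocalInvariants K p} (hPT : inv.SumLocalTermEqZero)
    (S : Set (HeightOneSpectrum (𝓞 K))) (q : HeightOneSpectrum (𝓞 K))
    (hSp : ∀ v ∉ S, v ≠ q → ((p : ℕ) : 𝓞 K) ∉ v.asIdeal)
    (hur : ∀ v ∉ S, v ≠ q → GaloisRep.IsUnramifiedAt v ρ)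
    (x : galoisCohomology (κ.twistModP ρ hM J) 1)
    (y : galoisCohomology (κ.invTwist.twistModP ρ' hM' J) 1)
    (hx : ∀ v ∉ S, v ≠ q → galoisCohomology.localization (κ.twistModP ρ hM J) (Sum.inr v) 1 x ∈
      DiscreteGaloisModule.unramifiedSubgroup (GaloisRep.toLocal v (κ.twistModP ρ hM J)) 1)
    (hy : ∀ v ∉ S, v ≠ q →
      galoisCohomology.localization (κ.invTwist.twistModP ρ' hM' J) (Sum.inr v) 1 y ∈
        DiscreteGaloisModule.unramifiedSubgroup (GaloisRep.toLocal v (κ.invTwist.twistModP ρ' hM' J)) 1)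
    (hS : ∀ v ∈ S, galoisCohomology.localization (κ.invTwist.twistModP ρ' hM' J) (Sum.inr v) 1 y = 0) :
    inv.localTerm (κ.twistModP ρ hM J) (Sum.inr q) x
      (galoisCohomology.map (κ.twistDualMap ρ ρ' p hM hM' J he) 1 y) = 0 := by
  haveI : NeZero p := ⟨(Fact.out : p.Prime).ne_zero⟩
  exact localTerm_pairingDual_eq_zero_of_unramified_outside_set
    (κ.gorensteinPairing_twistModP_smul ρ ρ' (mu K p) hM hM' J he) ((Fact.out : p.Prime).odd_of_ne_two hp)
    hPT (nsmul_twist_eq_zero hM J) S q x y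
    (fun v hvS hvq _ ht z =>
      toLocal_twistModP_apply_of_mem_absInertia κ ρ hM J v (hur v hvS hvq) (hSp v hvS hvq) ht z)
    (fun v hvS hvq _ ht f =>
      toLocal_tateDual_twistModP_apply_of_mem_absInertia κ ρ hM J v (hur v hvS hvq) (hSp v hvS hvq) ht f)
    hx hy hS

/-- **STEP 4 on the twists in EXACTLY the hypothesis shape of skeleton v5's `stub_stepsTwoFourX9`**
(`S : Set`, the Selmer-side class `Ψ` unramified off `S`, `loc_v (T^[ε] Ψ) = 0` for `v ∈ S` as a GLOBAL
iterate, `q ∉ S`) — every finite `v ∉ S` has `v ∤ p` and `ρ` unramified (so `S ⊇ {v ∣ p} ∪ {ramified}`,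
the prover's `S₀ ⊆ S`), `x ∈ H¹(K, 𝒯_J(ρ, κ))` unramified off `S ∪ {q}` (the Kolyvagin class `κ_q`): for
EVERY `k` the local term at `q` of `(T^k x, (twistDualMap)_* (T^ε Ψ))` vanishes — every member of the
coefficient family of MU-TRANSFER-PROOF (F7) is zero. [cite: MilneADT2006, Ch. I, Thm. 4.10(b)] -/
theorem localTerm_iterate_shiftH1_eq_zero_of_stub_hypotheses (hp : p ≠ 2)
    {inv : LocalInvariants K p} (hPT : inv.SumLocalTermEqZero)
    (S : Set (HeightOneSpectrum (𝓞 K))) (q : HeightOneSpectrum (𝓞 K)) (hq : q ∉ S)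
    (hSp : ∀ v ∉ S, ((p : ℕ) : 𝓞 K) ∉ v.asIdeal)
    (hur : ∀ v ∉ S, GaloisRep.IsUnramifiedAt v ρ)
    (x : galoisCohomology (κ.twistModP ρ hM J) 1)
    (hx : ∀ v ∉ S, v ≠ q → galoisCohomology.localization (κ.twistModP ρ hM J) (Sum.inr v) 1 x ∈
      DiscreteGaloisModule.unramifiedSubgroup (GaloisRep.toLocal v (κ.twistModP ρ hM J)) 1)
    (Ψ : galoisCohomology (κ.invTwist.twistModP ρ' hM' J) 1)
    (hΨ : ∀ v ∉ S, galoisCohomology.localization (κ.invTwist.twistModP ρ' hM' J) (Sum.inr v) 1 Ψ ∈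
      DiscreteGaloisModule.unramifiedSubgroup (GaloisRep.toLocal v (κ.invTwist.twistModP ρ' hM' J)) 1)
    (ε : ℕ)
    (hΨS : ∀ v ∈ S, galoisCohomology.localization (κ.invTwist.twistModP ρ' hM' J) (Sum.inr v) 1
      ((κ.invTwist.shiftH1 ρ' hM' J)^[ε] Ψ) = 0)
    (k : ℕ) :
    inv.localTerm (κ.twistModP ρ hM J) (Sum.inr q) ((κ.shiftH1 ρ hM J)^[k] x)
      (galoisCohomology.map (κ.twistDualMap ρ ρ' p hM hM' J he) 1
        ((κ.invTwist.shiftH1 ρ' hM' J)^[ε] Ψ)) = 0 := by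
  have _ := hq
  exact localTerm_twistDualMap_eq_zero_of_unramified_outside_set κ ρ ρ' hM hM' J he hp hPT S q
    (fun v hvS _ => hSp v hvS) (fun v hvS _ => hur v hvS) _ _
    (fun v hvS hvq => iterate_shiftH1_localization_mem_unramifiedSubgroup κ ρ hM J v (hx v hvS hvq) k)
    (fun v hvS _ => iterate_shiftH1_localization_mem_unramifiedSubgroup κ.invTwist ρ' hM' J v (hΨ v hvS) ε)
    hΨS

/-! ### §3 The same read on LOCAL classes at `q` (restricted `twistContPairing`; the `q`-term currency) -/

variable [LocallyCompactSpace (absoluteGaloisGroup K)]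

/-- **STEP 4 in the stub's hypothesis shape, read on local classes at `q`**:
`inv_q(T_q^k (loc_q x) ∪ loc_q (T^ε Ψ)) = 0` for every `k`, the cup product being that of k6-ty's
`twistContPairing` restricted to `Γ_{K_q}`, `T_q = H¹(twistModPShift|_{Γ_{K_q}})`.
[cite: MilneADT2006, Ch. I, Thm. 4.10(b)] -/
theorem inv_cupProduct_restrict_iterate_localShift_eq_zero_of_stub_hypotheses (hp : p ≠ 2)
    {inv : LocalInvariants K p} (hPT : inv.SumLocalTermEqZero)
    (S : Set (HeightOneSpectrum (𝓞 K))) (q : HeightOneSpectrum (𝓞 K)) (hq : q ∉ S)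
    [LocallyCompactSpace (absoluteGaloisGroup (Place.Completion (Sum.inr q : Place K)))]
    (hSp : ∀ v ∉ S, ((p : ℕ) : 𝓞 K) ∉ v.asIdeal)
    (hur : ∀ v ∉ S, GaloisRep.IsUnramifiedAt v ρ)
    (x : galoisCohomology (κ.twistModP ρ hM J) 1)
    (hx : ∀ v ∉ S, v ≠ q → galoisCohomology.localization (κ.twistModP ρ hM J) (Sum.inr v) 1 x ∈
      DiscreteGaloisModule.unramifiedSubgroup (GaloisRep.toLocal v (κ.twistModP ρ hM J)) 1)
    (Ψ : galoisCohomology (κ.invTwist.twistModP ρ' hM' J) 1)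
    (hΨ : ∀ v ∉ S, galoisCohomology.localization (κ.invTwist.twistModP ρ' hM' J) (Sum.inr v) 1 Ψ ∈
      DiscreteGaloisModule.unramifiedSubgroup (GaloisRep.toLocal v (κ.invTwist.twistModP ρ' hM' J)) 1)
    (ε : ℕ)
    (hΨS : ∀ v ∈ S, galoisCohomology.localization (κ.invTwist.twistModP ρ' hM' J) (Sum.inr v) 1
      ((κ.invTwist.shiftH1 ρ' hM' J)^[ε] Ψ) = 0)
    (k : ℕ) :
    inv (Sum.inr q)
      (((κ.twistContPairing ρ ρ' (mu K p) hM hM' J he).restrict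
          (absGaloisRestrict K (Place.Completion (Sum.inr q : Place K)))).cupProduct
        ((galoisCohomology.map ((κ.twistModPShift ρ hM J).restrictField (q.adicCompletion K)) 1)^[k]
          (galoisCohomology.localization (κ.twistModP ρ hM J) (Sum.inr q) 1 x))
        (galoisCohomology.localization (κ.invTwist.twistModP ρ' hM' J) (Sum.inr q) 1
          ((κ.invTwist.shiftH1 ρ' hM' J)^[ε] Ψ))) = 0 := by
  rw [← localization_iterate_shiftH1, ← localization_cupProduct_twistContPairing]
  have h := localTerm_iterate_shiftH1_eq_zero_of_stub_hypotheses κ ρ ρ' hM hM' J he hp hPT S q hq hSp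
    hur x hx Ψ hΨ ε hΨS k
  rw [show κ.twistDualMap ρ ρ' p hM hM' J he = pairingDualIntertwining
      (κ.gorensteinPairing_twistModP_smul ρ ρ' (mu K p) hM hM' J he) from rfl,
    DiscreteGaloisModule.localTerm_pairingDual] at h
  exact h

end Twist

end Summit.BirchSwinnertonDyer.BirchSwinnertonDyer.Rank1Residual.StepFour

end
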